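import Summits.Ventures.YMGap.RobustBall.PerturbedSpecification
import HarnessLib

/-!
# Venture YMGap, track ROBUST-BALL — existence of DLR states of the perturbed specification

HONEST FRAMING. WHAT THIS IS: a venture file (cell `pub-ymgap`, track Y2 ROBUST-BALL, seat rb-p1) proving
that the perturbed lattice Yang–Mills specification `perturbedYM ρ β W supp` on `ℤ^d`
(`PerturbedSpecification.lean`) HAS a Gibbs measure for every member with CONTINUOUS interaction terms:
`(perturbedGibbsMeasures ρ β W supp).Nonempty`. With the uniqueness half of the robust Dobrushin door
this gives `HasUniqueGibbsMeasure` for the member (the `Subsingleton ∧ Nonempty` currency of the tree's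
`MassGapAt`). The tree's existence theorem `ymGibbsMeasures_nonempty` is Wilson-specific (limits of
TORUS Wilson states); here the finite-volume kernels `γ_{Λₙ}(· | η₀)` with a fixed boundary condition
along an exhaustion `Λₙ ↑ ℤ^d` replace the torus states (Georgii 2011, Thm. 4.17 / (4.18): every
cluster point of finite-volume Gibbs distributions of a quasilocal specification is a Gibbs measure;
Friedli–Velenik 2017, Thm. 6.26 with Lemma 6.28). WHAT THIS IS NOT: no uniqueness, no clustering, no
number; existence fails in general for merely bounded measurable (non-quasilocal) interactions, which
is why the carrier of the ball asks continuity of each `W_X`. Lattice statement only.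

## Contents

* Generic (`IsSpecification γ` on `LGConfig d G`, compact Hausdorff second-countable `G`):
  `IsSpecification.bind_consistent` (`(γ Λ' η).bind (γ Δ) = γ Λ' η` for `Δ ⊆ Λ'`),
  `exists_isGibbsMeasure_of_feller` — a FELLER specification (kernel averages of bounded continuous
  functions are continuous in the boundary condition) has a Gibbs measure: compactness of
  `ProbabilityMeasure (LGConfig d G)` (Mathlib, Riesz–Markov/Prokhorov), consistency along the
  exhaustion, Feller continuity to pass to the limit, and `μ.bind (γ Δ) = μ` tested on bounded
  continuous functions (`ext_of_forall_lintegral_eq_of_IsFiniteMeasure`).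
* The perturbed kernels: integral formula, Feller property (`continuous_integral_perturbedYM`) for
  continuous `ρ` and continuous terms `W_X` — the proofs of the tree's `LatticeGaugeDLRGibbsProofs`
  §Kernel with the energy `perturbedEnergy` in place of `-β S_Λ`.
* `perturbedGibbsMeasures_nonempty` — THE EXISTENCE THEOREM for the member.

## References

* H.-O. Georgii, *Gibbs Measures and Phase Transitions* (2011), Def. 4.11 ff. (quasilocal / Feller
  specifications), Thm. 4.17 and (4.18), Cor. 4.13 (existence on a compact state space).
* S. Friedli, Y. Velenik (2017), Thm. 6.26, Lemma 6.28, Exercise 6.13.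
* The tree: `Literature/MathematicalPhysics/QuantumLattice/LatticeGaugeDLRGibbsProofs.lean`,
  `…/LatticeGaugeDLRLimitPointsProofs.lean` (the Wilson/torus template).
-/

noncomputable section

open MeasureTheory Filter Topology Function ProbabilityTheory
open scoped ProbabilityTheory
open Literature.Probability.LatticeModels
open Literature.MathematicalPhysics.QuantumLattice
open Literature.MathematicalPhysics.QuantumFieldTheory hiding ZdEdge

namespace Summit.Ventures.YMGap.RobustBall

/-! ### Generic: a Feller specification on `LGConfig d G` has a Gibbs measure -/

section Generic

variable {d : ℕ} {G : Type*} [MeasurableSpace G]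

/-- **Consistency in monadic form**: for a specification `γ` and `Δ ⊆ Λ'`,
`(γ Λ' η).bind (γ Δ) = γ Λ' η` (Georgii 2011, Def. 1.23 (iii), `γ_{Λ'} γ_Δ = γ_{Λ'}`). -/
theorem bind_consistent {γ : Specification (ZdEdge d) G} (hγ : IsSpecification γ)
    {Δ Λ' : Finset (ZdEdge d)} (h : Δ ⊆ Λ') (η : LGConfig d G) :
    (γ Λ' η).bind (γ Δ) = γ Λ' η :=
  Measure.ext fun A hA => by
    rw [Measure.bind_apply hA (hγ.measurable_fun Δ).aemeasurable]
    exact hγ.consistent h η A hA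

/-- Consistency in integral form for bounded continuous nonnegative test functions:
`∫⁻ (∫⁻ f dγ_Δ(·|σ)) dγ_{Λ'}(·|η)(σ) = ∫⁻ f dγ_{Λ'}(·|η)` for `Δ ⊆ Λ'`. -/
theorem lintegral_lintegral_consistent {γ : Specification (ZdEdge d) G} (hγ : IsSpecification γ)
    {Δ Λ' : Finset (ZdEdge d)} (h : Δ ⊆ Λ') (η : LGConfig d G) {f : LGConfig d G → ENNReal}
    (hf : Measurable f) :
    ∫⁻ σ, (∫⁻ U, f U ∂(γ Δ σ)) ∂(γ Λ' η) = ∫⁻ U, f U ∂(γ Λ' η) := by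
  rw [← Measure.lintegral_bind (hγ.measurable_fun Δ).aemeasurable hf.aemeasurable, bind_consistent hγ h η]

/-- Consistency for observables: `∫ (∫ F dγ_Δ(·|σ)) dγ_{Λ'}(·|η)(σ) = ∫ F dγ_{Λ'}(·|η)` for
`Δ ⊆ Λ'` and `F` integrable for `γ_{Λ'}(·|η)` (Mathlib `Kernel.integral_comp` for the kernel `γ_Δ`,
as in the tree's `IsGibbsMeasure.integral_integral_eq`). -/
theorem integral_integral_consistent {γ : Specification (ZdEdge d) G} (hγ : IsSpecification γ)
    {Δ Λ' : Finset (ZdEdge d)} (h : Δ ⊆ Λ') (η : LGConfig d G) {F : LGConfig d G → ℝ}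
    (hF : Integrable F (γ Λ' η)) :
    ∫ σ, (∫ U, F U ∂(γ Δ σ)) ∂(γ Λ' η) = ∫ U, F U ∂(γ Λ' η) := by
  let κ : Kernel (LGConfig d G) (LGConfig d G) := ⟨γ Δ, hγ.measurable_fun Δ⟩
  have hcomp : (κ ∘ₖ Kernel.const Unit (γ Λ' η)) () = γ Λ' η := by
    rw [Kernel.comp_apply, Kernel.const_apply]
    exact bind_consistent hγ h η
  have hfi : Integrable F ((κ ∘ₖ Kernel.const Unit (γ Λ' η)) ()) := by rwa [hcomp]
  have key := Kernel.integral_comp hfi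
  rw [hcomp, Kernel.const_apply] at key
  exact key.symm

/-- An exhaustion of the countable link set by finite sets, cofinal for inclusion:
every finite `Δ` is contained in `Λ n` for all large `n`. -/
theorem exists_exhaustion (d : ℕ) :
    ∃ Λ : ℕ → Finset (ZdEdge d), ∀ Δ : Finset (ZdEdge d), ∀ᶠ n in atTop, Δ ⊆ Λ n := by
  classical
  obtain ⟨f, hf⟩ := Countable.exists_injective_nat (ZdEdge d)
  refine ⟨fun n => (Finset.range n).preimage f hf.injOn, fun Δ => ?_⟩
  refine Filter.eventually_atTop.2 ⟨(Δ.image f).sup id + 1, fun n hn e he => ?_⟩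
  rw [Finset.mem_preimage, Finset.mem_range]
  have : f e ≤ (Δ.image f).sup id := Finset.le_sup (f := id) (Finset.mem_image_of_mem f he)
  omega

variable [TopologicalSpace G] [CompactSpace G] [BorelSpace G] [T2Space G] [SecondCountableTopology G]

/-- **Existence of a Gibbs measure for a Feller specification on the compact configuration space
`LGConfig d G`** (Georgii 2011, Thm. 4.17 with (4.18) and Cor. 4.13; Friedli–Velenik 2017,
Thm. 6.26): if `γ` is a specification whose kernel averages of bounded continuous functions are
continuous in the boundary condition, then `𝒢(γ) ≠ ∅`. Proof: the finite-volume distributions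
`γ_{Λₙ}(· | η₀)` along an exhaustion have a weakly convergent subsequence (the space of probability
measures on the compact metrizable `LGConfig d G` is compact, Mathlib); for bounded continuous `f` and
`Δ ⊆ Λₙ`, consistency gives `γ_{Λₙ}(γ_Δ f | η₀) = γ_{Λₙ}(f | η₀)`, and `γ_Δ f` is bounded continuous
(Feller), so the limit `μ` satisfies `μ(γ_Δ f) = μ(f)`; bounded continuous functions separate finite
Borel measures, hence `μ γ_Δ = μ`. -/
theorem exists_isGibbsMeasure_of_feller [Nonempty G] {γ : Specification (ZdEdge d) G}
    (hγ : IsSpecification γ)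
    (hFeller : ∀ (Λ : Finset (ZdEdge d)) (F : LGConfig d G → ℝ), Continuous F → ∀ C : ℝ,
      (∀ U, |F U| ≤ C) → Continuous fun η => ∫ U, F U ∂(γ Λ η)) :
    (gibbsMeasures γ).Nonempty := by
  classical
  obtain ⟨Λs, hΛs⟩ := exists_exhaustion d
  let η₀ : LGConfig d G := fun _ => Classical.arbitrary G
  haveI hprob : ∀ Λ η, IsProbabilityMeasure (γ Λ η) := hγ.isProbability
  let P : ℕ → ProbabilityMeasure (LGConfig d G) := fun n => ⟨γ (Λs n) η₀, inferInstance⟩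
  obtain ⟨μ, -, φ, hφ, hlim⟩ :=
    (isCompact_univ (X := ProbabilityMeasure (LGConfig d G))).tendsto_subseq fun n => Set.mem_univ (P n)
  refine ⟨(μ : Measure (LGConfig d G)), inferInstance, fun Δ A hA => ?_⟩
  have hweak := ProbabilityMeasure.tendsto_iff_forall_integral_tendsto.1 hlim
  -- kernel averages of a function bounded by `C` are bounded by `C`
  have hbound : ∀ (Λ : Finset (ZdEdge d)) {F : LGConfig d G → ℝ} {C : ℝ}, (∀ U, |F U| ≤ C) →
      ∀ η, |∫ U, F U ∂(γ Λ η)| ≤ C := fun Λ F C hC η => by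
    have h := norm_integral_le_of_norm_le_const (μ := γ Λ η) (f := F) (C := C)
      (ae_of_all _ fun U => by simpa [Real.norm_eq_abs] using hC U)
    simpa [Real.norm_eq_abs] using h
  -- Step 1: `μ(F) = μ(γ_Δ F)` for bounded continuous `F`
  have core : ∀ F : LGConfig d G → ℝ, Continuous F → ∀ C : ℝ, (∀ U, |F U| ≤ C) →
      ∫ U, F U ∂(μ : Measure (LGConfig d G)) =
        ∫ η, (∫ U, F U ∂(γ Δ η)) ∂(μ : Measure (LGConfig d G)) := by
    intro F hFc C hC
    let Fb : BoundedContinuousFunction (LGConfig d G) ℝ :=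
      BoundedContinuousFunction.ofNormedAddCommGroup F hFc C
        (fun U => by simpa [Real.norm_eq_abs] using hC U)
    let Gb : BoundedContinuousFunction (LGConfig d G) ℝ :=
      BoundedContinuousFunction.ofNormedAddCommGroup (fun η => ∫ U, F U ∂(γ Δ η))
        (hFeller Δ F hFc C hC) C (fun η => by simpa [Real.norm_eq_abs] using hbound Δ hC η)
    have h1 : Tendsto (fun k => ∫ U, Fb U ∂(P (φ k) : Measure (LGConfig d G))) atTop
        (𝓝 (∫ U, Fb U ∂(μ : Measure (LGConfig d G)))) := hweak Fb
    have h2 : Tendsto (fun k => ∫ U, Gb U ∂(P (φ k) : Measure (LGConfig d G))) atTop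
        (𝓝 (∫ U, Gb U ∂(μ : Measure (LGConfig d G)))) := hweak Gb
    -- eventually the two sequences agree (consistency along the exhaustion)
    have hev : ∀ᶠ k in atTop, ∫ U, Fb U ∂(P (φ k) : Measure (LGConfig d G)) =
        ∫ U, Gb U ∂(P (φ k) : Measure (LGConfig d G)) := by
      have hsub : ∀ᶠ k in atTop, Δ ⊆ Λs (φ k) := hφ.tendsto_atTop.eventually (hΛs Δ)
      filter_upwards [hsub] with k hk
      change ∫ U, F U ∂(γ (Λs (φ k)) η₀) = ∫ η, (∫ U, F U ∂(γ Δ η)) ∂(γ (Λs (φ k)) η₀)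
      exact (integral_integral_consistent hγ hk η₀
        (integrable_of_bound hFc.measurable.aestronglyMeasurable hC)).symm
    exact tendsto_nhds_unique (h1.congr' hev) h2
  -- Step 2: `μ = μ.bind (γ Δ)` as measures, tested on bounded continuous functions
  have hκ : Measurable (γ Δ) := hγ.measurable_fun Δ
  have hμeq : (μ : Measure (LGConfig d G)) = (μ : Measure (LGConfig d G)).bind (γ Δ) := by
    refine ext_of_forall_lintegral_eq_of_IsFiniteMeasure fun f => ?_
    have hfm : Measurable fun x => (f x : ENNReal) :=
      measurable_coe_nnreal_ennreal.comp f.continuous.measurable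
    rw [Measure.lintegral_bind hκ.aemeasurable hfm.aemeasurable]
    have hfc : Continuous fun x => (f x : ℝ) := NNReal.continuous_coe.comp f.continuous
    have hfb : ∀ x, |(f x : ℝ)| ≤ nndist f 0 := fun x => by
      rw [abs_of_nonneg (f x).coe_nonneg]
      exact_mod_cast BoundedContinuousFunction.NNReal.upper_bound f x
    have hint : ∀ (m : Measure (LGConfig d G)) [IsFiniteMeasure m],
        ∫⁻ x, (f x : ENNReal) ∂m = ENNReal.ofReal (∫ x, (f x : ℝ) ∂m) := by
      intro m _
      rw [← BoundedContinuousFunction.toReal_lintegral_coe_eq_integral,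
        ENNReal.ofReal_toReal (BoundedContinuousFunction.lintegral_lt_top_of_nnreal m f).ne]
    have hpt : (fun η => ∫⁻ x, (f x : ENNReal) ∂(γ Δ η)) = fun η =>
        ENNReal.ofReal (∫ x, (f x : ℝ) ∂(γ Δ η)) := funext fun η => hint _
    rw [hint, hpt, ← ofReal_integral_eq_lintegral_ofReal]
    · rw [core _ hfc _ hfb]
    · exact integrable_of_bound (hFeller Δ _ hfc _ hfb).measurable.aestronglyMeasurable (hbound Δ hfb)
    · exact ae_of_all _ fun η => integral_nonneg fun x => (f x).coe_nonneg
  -- Step 3: the DLR equation for `A`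
  calc ∫⁻ η, γ Δ η A ∂(μ : Measure (LGConfig d G))
      = ((μ : Measure (LGConfig d G)).bind (γ Δ)) A := (Measure.bind_apply hA hκ.aemeasurable).symm
    _ = (μ : Measure (LGConfig d G)) A := by rw [← hμeq]

end Generic

/-! ### The perturbed kernels: integral formula and Feller property -/

section Kernel

variable {d N : ℕ} {G : Type*} [Group G] [TopologicalSpace G] [IsTopologicalGroup G]
  [CompactSpace G] [MeasurableSpace G] [BorelSpace G] [SecondCountableTopology G]
  (ρ : G →* Matrix (Fin N) (Fin N) ℂ)

/-- **Integral formula for the perturbed kernel**: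
`∫ F dγ^W_Λ(· | η) = (∫ F(ζ η_{Λᶜ}) e^{φ_Λ(ζ η_{Λᶜ})} dζ) / (∫ e^{φ_Λ(ζ η_{Λᶜ})} dζ)`, `φ_Λ` the perturbed
energy, `dζ` product Haar on `G^Λ` (Georgii 2011, Def. 2.9). -/
theorem integral_perturbedYM (hρ : Continuous ρ) (β : ℝ) {W : Potential (ZdEdge d) G}
    (hWc : ∀ X, Continuous (W X)) (supp : Finset (ZdEdge d) → Finset (Finset (ZdEdge d)))
    (Λ : Finset (ZdEdge d)) {F : LGConfig d G → ℝ} (hF : Measurable F) (η : LGConfig d G) :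
    ∫ U, F U ∂(perturbedYM ρ β W supp Λ η) =
      (∫ ζ, F (glueWith Λ ζ η) * Real.exp (perturbedEnergy ρ β W supp Λ (glueWith Λ ζ η))
          ∂(Measure.pi fun _ : ↥Λ => haarProbability G)) /
        ∫ ζ, Real.exp (perturbedEnergy ρ β W supp Λ (glueWith Λ ζ η))
          ∂(Measure.pi fun _ : ↥Λ => haarProbability G) := by
  have hg : Measurable (glueWith Λ · η) := measurable_glueWith Λ η
  have hw : Continuous fun U : LGConfig d G => Real.exp (perturbedEnergy ρ β W supp Λ U) :=
    Real.continuous_exp.comp (continuous_perturbedEnergy ρ hρ β hWc supp Λ)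
  unfold perturbedYM
  rw [integral_tilted, integral_map hg.aemeasurable hw.aestronglyMeasurable,
    integral_map hg.aemeasurable]
  · simp only [smul_eq_mul]
    rw [← integral_div]
    refine congrArg _ (funext fun ζ => ?_)
    ring
  · exact ((hw.measurable.div_const _).mul hF).aestronglyMeasurable

/-- The un-normalised perturbed kernel integrals of a bounded continuous `F` are continuous in the
boundary condition (jointly continuous integrand, compact fibre `G^Λ`). -/
theorem continuous_integral_glueWith_perturbed (hρ : Continuous ρ) (β : ℝ) {W : Potential (ZdEdge d) G}
    (hWc : ∀ X, Continuous (W X)) (supp : Finset (ZdEdge d) → Finset (Finset (ZdEdge d)))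
    (Λ : Finset (ZdEdge d)) {F : LGConfig d G → ℝ} (hF : Continuous F) {C : ℝ} (hC : ∀ U, |F U| ≤ C) :
    Continuous fun η : LGConfig d G =>
      ∫ ζ, F (glueWith Λ ζ η) * Real.exp (perturbedEnergy ρ β W supp Λ (glueWith Λ ζ η))
        ∂(Measure.pi fun _ : ↥Λ => haarProbability G) := by
  have hw : Continuous fun U : LGConfig d G => Real.exp (perturbedEnergy ρ β W supp Λ U) :=
    Real.continuous_exp.comp (continuous_perturbedEnergy ρ hρ β hWc supp Λ)
  obtain ⟨B, hB⟩ := exists_bound_of_continuous hw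
  have hΦ : Continuous fun p : LGConfig d G × (↥Λ → G) =>
      F (glueWith Λ p.2 p.1) * Real.exp (perturbedEnergy ρ β W supp Λ (glueWith Λ p.2 p.1)) :=
    (hF.comp (continuous_glueWith_prod Λ)).mul (hw.comp (continuous_glueWith_prod Λ))
  refine continuous_integral_of_bound (fun η => hΦ.comp (Continuous.prodMk_right η))
    (fun ζ => hΦ.comp (Continuous.prodMk_left ζ)) (C := C * B) fun η ζ => ?_
  rw [abs_mul]
  exact mul_le_mul (hC _) (hB _) (abs_nonneg _) ((abs_nonneg _).trans (hC (glueWith Λ ζ η)))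

/-- **Feller property of the perturbed specification**: for continuous `ρ`, continuous interaction
terms and bounded continuous `F`, `η ↦ ∫ F dγ^W_Λ(· | η)` is continuous (Georgii 2011, Def. 4.11 ff.;
Friedli–Velenik 2017, Lemma 6.28). -/
theorem continuous_integral_perturbedYM (hρ : Continuous ρ) (β : ℝ) {W : Potential (ZdEdge d) G}
    (hWc : ∀ X, Continuous (W X)) (supp : Finset (ZdEdge d) → Finset (Finset (ZdEdge d)))
    (Λ : Finset (ZdEdge d)) {F : LGConfig d G → ℝ} (hF : Continuous F) {C : ℝ} (hC : ∀ U, |F U| ≤ C) :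
    Continuous fun η => ∫ U, F U ∂(perturbedYM ρ β W supp Λ η) := by
  simp only [integral_perturbedYM ρ hρ β hWc supp Λ hF.measurable]
  have hZ : Continuous fun η : LGConfig d G =>
      ∫ ζ, Real.exp (perturbedEnergy ρ β W supp Λ (glueWith Λ ζ η))
        ∂(Measure.pi fun _ : ↥Λ => haarProbability G) := by
    have h := continuous_integral_glueWith_perturbed ρ hρ β hWc supp Λ (F := fun _ => (1 : ℝ))
      continuous_const (C := 1) (fun _ => by simp)
    simpa using h
  refine (continuous_integral_glueWith_perturbed ρ hρ β hWc supp Λ hF hC).div hZ fun η => ?_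
  have hw : Continuous fun ζ : ↥Λ → G =>
      Real.exp (perturbedEnergy ρ β W supp Λ (glueWith Λ ζ η)) :=
    Real.continuous_exp.comp ((continuous_perturbedEnergy ρ hρ β hWc supp Λ).comp
      ((continuous_glueWith_prod Λ).comp (Continuous.prodMk_right η)))
  obtain ⟨B, hB⟩ := exists_bound_of_continuous hw
  exact (integral_exp_pos (integrable_of_bound hw.aestronglyMeasurable hB)).ne'

end Kernel

/-! ### Existence of DLR states of the member -/

section Existence

variable {d N : ℕ} {G : Type*} [Group G] [TopologicalSpace G] [IsTopologicalGroup G]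
  [CompactSpace G] [MeasurableSpace G] [BorelSpace G] [T2Space G] [SecondCountableTopology G]
  (ρ : G →* Matrix (Fin N) (Fin N) ℂ)

/-- **Existence of DLR states for the perturbed lattice Yang–Mills action** (Georgii 2011,
Thm. 4.17 / Cor. 4.13; Friedli–Velenik 2017, Thm. 6.26): for a continuous representation `ρ` of a
compact Hausdorff second-countable group, every real `β`, and every link potential `W` with CONTINUOUS
terms depending only on their own links and locally finitely supported by `supp`,
`𝒢(perturbedYM ρ β W supp) ≠ ∅`. -/
theorem perturbedGibbsMeasures_nonempty (hρ : Continuous ρ) (β : ℝ) {W : Potential (ZdEdge d) G}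
    (hWc : ∀ X, Continuous (W X)) (hWdep : ∀ X, DependsOn (W X) (↑X : Set (ZdEdge d)))
    {supp : Finset (ZdEdge d) → Finset (Finset (ZdEdge d))} (hsupp : W.IsSupportedBy supp) :
    (perturbedGibbsMeasures (d := d) ρ β W supp).Nonempty := by
  have hW : W.IsAdapted := fun X => ⟨hWdep X, (hWc X).measurable⟩
  have hWb : ∀ X, ∃ C, ∀ U, |W X U| ≤ C := fun X => exists_bound_of_continuous (hWc X)
  exact exists_isGibbsMeasure_of_feller (isSpecification_perturbedYM ρ hρ β hW hWb hsupp)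
    fun Λ F hF C hC => continuous_integral_perturbedYM ρ hρ β hWc supp Λ hF hC

end Existence

end Summit.Ventures.YMGap.RobustBall
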